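import Summits.Ventures.CertifiedQuantumChemistry.Rows.StrongCouplingDoublonBound
import Summits.Ventures.CertifiedQuantumChemistry.Hamiltonians.HubbardRingTV
import Literature.MathematicalPhysics.QuantumChemistry.RelaxationEnergyAttained
import Summits.Ventures.CertifiedQuantumChemistry.Rows.HubbardHalfFilledStrongCoupling
import Summits.Ventures.CertifiedQuantumChemistry.Rows.LiebSingletBridge
import HarnessLib

/-!
# Ventures/CertifiedQuantumChemistry — Rows/HubbardRingTVDoublonBound.lean: CLAIM N step (1) FOR THE
# TV-H FILES — on every feasible pair of the two-positivity sector programme of `hubbardRingTV L t U`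
# at half filling, an energy `≤ 0` forces total doublon weight `≤ 16 t² L³ / U²`

HONEST FRAMING (verbatim): certified bounds for a stated model Hamiltonian in a stated basis; not a
claim about the real molecule beyond that model. Nothing here is a state, a row, a claim node or a
value of record; the statements are about ARBITRARY (resp. optimal) feasible pairs of the abstract
`D, Q, G` programme with sector rows of the cell's Hubbard-ring test-vector tables
`hubbardRingTV L t U` (`Hamiltonians/HubbardRingTV.lean`; the files `TVH_L{L}_N{L}_U{U}.FCIDUMP` are
`hubbardRingTV L 1 U`).

Seat rdm-B (gen 35), zero compute; theorems only (no `def`). The instantiation of the sibling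
`Rows/StrongCouplingDoublonBound.lean` (the bound for any Hubbard-type table: zero-diagonal one-body
integrals bounded by `τ`, on-site two-body integrals `U`) on the cell's files — the opening sentence
of CLAIM N (HOME/INBOX L765 (ii); `STRUCTURE.md` §2.2.13 (ii): "`OPT ≥ −C√(Σd) + U·Σd`, so
`0 ≥ OPT` forces `Σ_i d_i ≤ C²ε²`") kernel-checked for `TVH`:

* `hubbardRingTV_h_diag` / `norm_hubbardRingTV_h_le` / `hubbardRingTV_eri` — the TV-H table IS
  Hubbard-type: `h_pp = 0` (`ringAdj` is irreflexive), `‖h_pq‖ ≤ |t|`, `(pq|rs) = U·[p = q = r = s]`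
  (cast to `ℂ`), `E_core = 0`.
* **`hubbardRingTV_re_rdmEnergy_ge`** — for every feasible pair of the `D, Q, G` sector programme of
  `hubbardRingTV L t U` at half filling `a + b = L ≥ 2`: `Re E(γ, Γ) ≥ U·s − 4|t| L√L·√s`, `s` the
  total doublon weight `Σ_p Re Γ_{(p↑,p↓),(p↑,p↓)}`.
* **`hubbardRingTV_sum_doublon_le_sq`** — with `U > 0`, every such pair whose energy is `≤ 0` has
  `s ≤ (4|t| L√L / U)²`, uniformly in the pair (what makes every scaled variable of CLAIM N bounded
  along `U → ∞`).
* `hubbardRingTV_exists_optimal_sum_doublon_le_sq` — an OPTIMAL pair exists (its energy IS the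
  value `pqgSectorEnergy`; `Literature…RelaxationEnergyAttained`) and whenever that value is `≤ 0`
  (the words' `OPT ≤ E₀ ≤ 0`) its doublon weight obeys the bound.

* (appended, same gen) **`hubbardRingTV_sectorGroundEnergy_le_zero`** — at half filling the
  TV-H sector ground energy is `≤ 0` (Rayleigh–Ritz at the configuration `|α↑ ∪ αᶜ↓⟩`: no doublon,
  zero diagonal hopping — the typer's pencil / singly-occupied lemmas of
  `Rows/HubbardHalfFilledStrongCoupling.lean` through the T-06 bridge `hubbardRingTV_hamiltonian_eq`);
  `hubbardRingTV_pqgSectorEnergy_le_zero` — hence the relaxation value is `≤ 0`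
  (`pqgSectorEnergy_le_sectorGroundEnergy`); **`hubbardRingTV_optimal_sum_doublon_le_sq`** — so the
  optimal pair's doublon bound holds UNCONDITIONALLY for every `L ≥ 2`, `t`, `U > 0`.

Everything is PROVED (0 sorry), standard axioms; no definitions, no named facts; no claim node,
hint, row or CERTIFIED cell depends on it. References (docstring-only): as in the sibling file.
-/

noncomputable section

namespace Summit.Ventures.CertifiedQuantumChemistry

open Matrix Finset
open Literature.MathematicalPhysics.QuantumLattice Literature.MathematicalPhysics.QuantumChemistry
open scoped ComplexOrder

namespace StrongCouplingDoublon

/-! ### §3 The cell's files: the Hubbard-ring test vectors `hubbardRingTV L t U` -/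

section TVH

open Summit.Ventures.CertifiedQuantumChemistry.Hamiltonians

/-- The TV-H one-body table has zero diagonal (`ringAdj L p p` is false). [folklore] -/
theorem hubbardRingTV_h_diag (L : ℕ) (t U : ℚ) (p : Fin L) :
    ((hubbardRingTV L t U).h p p : ℂ) = 0 := by
  have h1 : ¬ Hamiltonians.ringAdj L p p := fun h => h.1 rfl
  simp [hubbardRingTV, h1]

/-- The TV-H one-body table is bounded by `|t|`: `‖h_pq‖ ≤ |t|`. [folklore] -/
theorem norm_hubbardRingTV_h_le (L : ℕ) (t U : ℚ) (p q : Fin L) :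
    ‖((hubbardRingTV L t U).h p q : ℂ)‖ ≤ |(t : ℝ)| := by
  simp only [hubbardRingTV]
  split_ifs
  · rw [Rat.cast_neg, norm_neg, ← Complex.ofReal_ratCast, Complex.norm_real, Real.norm_eq_abs]
  · simp

/-- The TV-H two-body table is on-site: `(pq|rs) = U·[p = q = r = s]` (cast to `ℂ`). [folklore] -/
theorem hubbardRingTV_eri (L : ℕ) (t U : ℚ) (p q r s : Fin L) :
    ((hubbardRingTV L t U).eri p q r s : ℂ) =
      if p = q ∧ q = r ∧ r = s then (((U : ℝ) : ℝ) : ℂ) else 0 := by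
  simp only [hubbardRingTV]
  split_ifs <;> simp

/-- **CLAIM N (1) FOR THE TV-H FILES, the energy bound.** For every feasible pair of the `D, Q, G`
sector programme of `hubbardRingTV L t U` at half filling `a + b = L ≥ 2`:
`Re E(γ, Γ) ≥ U·s − 4|t| L √L · √s`, `s` the total doublon weight. [folklore] -/
theorem hubbardRingTV_re_rdmEnergy_ge {L : ℕ} (hL : 2 ≤ L) (t U : ℚ) {a b : ℕ} (hN : a + b = L)
    {γ : Matrix (Orb (Fin L)) (Orb (Fin L)) ℂ}
    {Γ : Matrix (Orb (Fin L) × Orb (Fin L)) (Orb (Fin L) × Orb (Fin L)) ℂ}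
    (hf : IsDQGFeasibleSector a b γ Γ) :
    (U : ℝ) * ∑ p : Fin L, (Γ (orb p 0, orb p 1) (orb p 0, orb p 1)).re -
        4 * |(t : ℝ)| * L * Real.sqrt L *
          Real.sqrt (∑ p : Fin L, (Γ (orb p 0, orb p 1) (orb p 0, orb p 1)).re)
      ≤ (rdmEnergy (fun p q => ((hubbardRingTV L t U).h p q : ℂ))
          (fun p q r s => ((hubbardRingTV L t U).eri p q r s : ℂ))
          ((hubbardRingTV L t U).ecore : ℂ) γ Γ).re := by
  have hcard : a + b = Fintype.card (Fin L) := by rw [Fintype.card_fin]; exact hN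
  have hΛ : 2 ≤ Fintype.card (Fin L) := by rw [Fintype.card_fin]; exact hL
  have hb := re_rdmEnergy_ge hf hcard hΛ (norm_hubbardRingTV_h_le L t U)
    (hubbardRingTV_h_diag L t U) (U : ℝ) (hubbardRingTV_eri L t U) ((hubbardRingTV L t U).ecore : ℂ)
  have hcore : (((hubbardRingTV L t U).ecore : ℚ) : ℂ).re = 0 := by simp [hubbardRingTV]
  rw [hcore, Fintype.card_fin, zero_add] at hb
  exact hb

/-- **CLAIM N (1) FOR THE TV-H FILES, the doublon weight.** At half filling `a + b = L ≥ 2` with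
`U > 0`, every feasible pair of the sector programme of `hubbardRingTV L t U` whose energy is `≤ 0`
has total doublon weight `s ≤ (4|t| L√L / U)² = 16 t² L³ / U²` — uniformly in the pair, which is
what makes every scaled variable of CLAIM N bounded along `U → ∞`. [folklore] -/
theorem hubbardRingTV_sum_doublon_le_sq {L : ℕ} (hL : 2 ≤ L) (t : ℚ) {U : ℚ} (hU : 0 < U)
    {a b : ℕ} (hN : a + b = L) {γ : Matrix (Orb (Fin L)) (Orb (Fin L)) ℂ}
    {Γ : Matrix (Orb (Fin L) × Orb (Fin L)) (Orb (Fin L) × Orb (Fin L)) ℂ}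
    (hf : IsDQGFeasibleSector a b γ Γ)
    (hE : (rdmEnergy (fun p q => ((hubbardRingTV L t U).h p q : ℂ))
          (fun p q r s => ((hubbardRingTV L t U).eri p q r s : ℂ))
          ((hubbardRingTV L t U).ecore : ℂ) γ Γ).re ≤ 0) :
    ∑ p : Fin L, (Γ (orb p 0, orb p 1) (orb p 0, orb p 1)).re ≤
      (4 * |(t : ℝ)| * L * Real.sqrt L / U) ^ 2 := by
  have hcard : a + b = Fintype.card (Fin L) := by rw [Fintype.card_fin]; exact hN
  have hΛ : 2 ≤ Fintype.card (Fin L) := by rw [Fintype.card_fin]; exact hL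
  have hcore : (((hubbardRingTV L t U).ecore : ℚ) : ℂ).re = 0 := by simp [hubbardRingTV]
  have hU' : (0 : ℝ) < (U : ℝ) := by exact_mod_cast hU
  have hb := sum_doublon_le_sq hf hcard hΛ (norm_hubbardRingTV_h_le L t U)
    (hubbardRingTV_h_diag L t U) hU' (hubbardRingTV_eri L t U) (hnuc := ((hubbardRingTV L t U).ecore : ℂ))
    (by rw [hcore]; exact hE)
  rw [Fintype.card_fin] at hb
  exact hb

/-- **CLAIM N (1) AT THE OPTIMUM OF THE TV-H SECTOR PROGRAMME.** At half filling `a + b = L ≥ 2`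
(`a, b ≤ L`), `U > 0`: an OPTIMAL feasible pair exists (its energy IS the programme's value
`pqgSectorEnergy`, `Literature…RelaxationEnergyAttained`), and whenever that value is `≤ 0` (the
words' `OPT ≤ E₀ ≤ 0`) its total doublon weight is `≤ (4|t| L√L / U)²` — the opening sentence of
CLAIM N for the files `TVH_L{L}_N{L}_U{U}` = `hubbardRingTV L 1 U`, kernel-checked. [folklore] -/
theorem hubbardRingTV_exists_optimal_sum_doublon_le_sq {L : ℕ} (hL : 2 ≤ L) (t : ℚ) {U : ℚ}
    (hU : 0 < U) {a b : ℕ} (hN : a + b = L)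
    (hopt : pqgSectorEnergy (fun p q => ((hubbardRingTV L t U).h p q : ℂ))
          (fun p q r s => ((hubbardRingTV L t U).eri p q r s : ℂ))
          ((hubbardRingTV L t U).ecore : ℂ) a b ≤ 0) :
    ∃ (γ : Matrix (Orb (Fin L)) (Orb (Fin L)) ℂ)
      (Γ : Matrix (Orb (Fin L) × Orb (Fin L)) (Orb (Fin L) × Orb (Fin L)) ℂ),
      IsDQGFeasibleSector a b γ Γ ∧
      (rdmEnergy (fun p q => ((hubbardRingTV L t U).h p q : ℂ))
          (fun p q r s => ((hubbardRingTV L t U).eri p q r s : ℂ))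
          ((hubbardRingTV L t U).ecore : ℂ) γ Γ).re
        = pqgSectorEnergy (fun p q => ((hubbardRingTV L t U).h p q : ℂ))
          (fun p q r s => ((hubbardRingTV L t U).eri p q r s : ℂ))
          ((hubbardRingTV L t U).ecore : ℂ) a b ∧
      ∑ p : Fin L, (Γ (orb p 0, orb p 1) (orb p 0, orb p 1)).re ≤
        (4 * |(t : ℝ)| * L * Real.sqrt L / U) ^ 2 := by
  have ha : a ≤ Fintype.card (Fin L) := by rw [Fintype.card_fin]; omega
  have hb : b ≤ Fintype.card (Fin L) := by rw [Fintype.card_fin]; omega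
  obtain ⟨γ, Γ, hf, hE⟩ := exists_isDQGFeasibleSector_rdmEnergy_eq_pqgSectorEnergy
    (fun p q => ((hubbardRingTV L t U).h p q : ℂ))
    (fun p q r s => ((hubbardRingTV L t U).eri p q r s : ℂ)) ((hubbardRingTV L t U).ecore : ℂ)
    ha hb
  exact ⟨γ, Γ, hf, hE, hubbardRingTV_sum_doublon_le_sq hL t hU hN hf (by rw [hE]; exact hopt)⟩

/-! #### Appended (same gen): the hypothesis `pqgSectorEnergy ≤ 0` discharged at half filling -/

/-- **AT HALF FILLING THE TV-H SECTOR GROUND ENERGY IS `≤ 0`.** For `a + b = L` the `(a, b)` sector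
ground energy of `hubbardRingTV L t U` is non-positive: the occupation-basis vector `|α↑ ∪ αᶜ↓⟩`
(`|α| = a`) lies in the sector, has NO doubly occupied site, and the hopping Hamiltonian has zero
diagonal entry at a singly occupied configuration — so its Rayleigh quotient is `0` (the T-06 bridge
`hubbardRingTV_hamiltonian_eq`, the pencil form `hamiltonian_eq_add_smul_diagonal` and
`hamiltonian_zero_apply_eq_zero_of_singly` of `Rows/HubbardHalfFilledStrongCoupling.lean`, and the
sector variational principle `sectorGroundEnergy_le_of_rayleigh`). [folklore] -/
theorem hubbardRingTV_sectorGroundEnergy_le_zero {L : ℕ} (t U : ℚ) {a b : ℕ} (hN : a + b = L) :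
    sectorGroundEnergy (hubbardRingTV L t U).hamiltonian a b ≤ 0 := by
  classical
  obtain ⟨α, -, hα⟩ : ∃ α : Finset (Fin L), α ⊆ Finset.univ ∧ α.card = a :=
    Finset.exists_subset_card_eq (by rw [Finset.card_univ, Fintype.card_fin]; omega)
  have hβ : (αᶜ).card = b := by rw [Finset.card_compl, hα, Fintype.card_fin]; omega
  have hsec : IsInSector a b (Pi.single (pairSet α αᶜ) (1 : ℂ) : Fock (Orb (Fin L))) := by
    have h := isInSector_single_pairSet α αᶜ
    rwa [hα, hβ] at h
  have hne : (Pi.single (pairSet α αᶜ) (1 : ℂ) : Fock (Orb (Fin L))) ≠ 0 := by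
    intro h0
    have h1 := congrFun h0 (pairSet α αᶜ)
    simp at h1
  refine sectorGroundEnergy_le_of_rayleigh (hubbardRingTV_hamiltonian_isHermitian L t U) hsec hne ?_
  -- the Rayleigh numerator is the diagonal entry at `α↑ ∪ αᶜ↓`, which vanishes
  have hsingly : ∀ z : Fin L, orb z 0 ∈ pairSet α αᶜ ↔ orb z 1 ∉ pairSet α αᶜ := by
    intro z
    simp [Finset.mem_compl]
  have hd : doublyOccupied (pairSet α αᶜ) = ∅ := by
    rw [doublyOccupied, upPart_pairSet, downPart_pairSet, Finset.inter_compl]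
  have hdiag : (hubbardRingTV L t U).hamiltonian (pairSet α αᶜ) (pairSet α αᶜ) = 0 := by
    rw [hubbardRingTV_hamiltonian_eq, hamiltonian_eq_add_smul_diagonal, Matrix.add_apply,
      hamiltonian_zero_apply_eq_zero_of_singly (ringGraph L) (t : ℝ) hsingly hsingly,
      Matrix.smul_apply, Matrix.diagonal_apply_eq, hd]
    simp
  have hq : star (Pi.single (pairSet α αᶜ) (1 : ℂ) : Fock (Orb (Fin L))) ⬝ᵥ
      (hubbardRingTV L t U).hamiltonian *ᵥ Pi.single (pairSet α αᶜ) 1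
      = (hubbardRingTV L t U).hamiltonian (pairSet α αᶜ) (pairSet α αᶜ) := by
    rw [← Pi.single_star, star_one, Matrix.mulVec_single_one, single_dotProduct, one_mul,
      Matrix.col_apply]
  rw [hq, hdiag, zero_mul, Complex.zero_re]

/-- **Hence the TV-H relaxation value at half filling is `≤ 0`**: `E_PQG(a, b) ≤ E₀(a, b) ≤ 0`
(`pqgSectorEnergy_le_sectorGroundEnergy`, the relaxation is below the exact sector energy).
[folklore] -/
theorem hubbardRingTV_pqgSectorEnergy_le_zero {L : ℕ} (t U : ℚ) {a b : ℕ} (hN : a + b = L) :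
    pqgSectorEnergy (fun p q => ((hubbardRingTV L t U).h p q : ℂ))
        (fun p q r s => ((hubbardRingTV L t U).eri p q r s : ℂ))
        ((hubbardRingTV L t U).ecore : ℂ) a b ≤ 0 := by
  have ha : a ≤ Fintype.card (Fin L) := by rw [Fintype.card_fin]; omega
  have hb : b ≤ Fintype.card (Fin L) := by rw [Fintype.card_fin]; omega
  exact (pqgSectorEnergy_le_sectorGroundEnergy (hubbardRingTV_hamiltonian_isHermitian L t U) ha hb).trans
    (hubbardRingTV_sectorGroundEnergy_le_zero t U hN)

/-- **CLAIM N (1) AT THE OPTIMUM, UNCONDITIONALLY.** For every `L ≥ 2`, every `t` and every `U > 0`,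
at half filling `a + b = L` an optimal feasible pair of the `D, Q, G` sector programme of
`hubbardRingTV L t U` exists and its total doublon weight is `≤ (4|t| L√L / U)² = 16 t² L³ / U²` —
the opening sentence of CLAIM N for the TV-H files with no hypothesis left. [folklore] -/
theorem hubbardRingTV_optimal_sum_doublon_le_sq {L : ℕ} (hL : 2 ≤ L) (t : ℚ) {U : ℚ} (hU : 0 < U)
    {a b : ℕ} (hN : a + b = L) :
    ∃ (γ : Matrix (Orb (Fin L)) (Orb (Fin L)) ℂ)
      (Γ : Matrix (Orb (Fin L) × Orb (Fin L)) (Orb (Fin L) × Orb (Fin L)) ℂ),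
      IsDQGFeasibleSector a b γ Γ ∧
      (rdmEnergy (fun p q => ((hubbardRingTV L t U).h p q : ℂ))
          (fun p q r s => ((hubbardRingTV L t U).eri p q r s : ℂ))
          ((hubbardRingTV L t U).ecore : ℂ) γ Γ).re
        = pqgSectorEnergy (fun p q => ((hubbardRingTV L t U).h p q : ℂ))
          (fun p q r s => ((hubbardRingTV L t U).eri p q r s : ℂ))
          ((hubbardRingTV L t U).ecore : ℂ) a b ∧
      ∑ p : Fin L, (Γ (orb p 0, orb p 1) (orb p 0, orb p 1)).re ≤
        (4 * |(t : ℝ)| * L * Real.sqrt L / U) ^ 2 :=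
  hubbardRingTV_exists_optimal_sum_doublon_le_sq hL t hU hN
    (hubbardRingTV_pqgSectorEnergy_le_zero t U hN)

end TVH

end StrongCouplingDoublon

end Summit.Ventures.CertifiedQuantumChemistry
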